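import Summits.KontsevichZagierPeriods.KontsevichZagierPeriods.Theorems.LinRedNormalFormDihedralNormalFormStubBoundedStokesMove
import Summits.KontsevichZagierPeriods.KontsevichZagierPeriods.Theorems.LinRedNormalFormDihedralNormalFormStubBvStokes
import Literature.NumberTheory.Transcendental.KZUnfoldedStokesProofs
import Literature.NumberTheory.Transcendental.KZLogCalculusProofs
import Literature.NumberTheory.Transcendental.KZHomotopyMoves
import Literature.NumberTheory.Transcendental.KZProductIdeal
import Literature.NumberTheory.Transcendental.SemialgebraicMapsProofs
import Literature.NumberTheory.Transcendental.BeukersZetaThreeIntegralsLegendreProofs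

/-!
# Route KontsevichZagierPeriods/UnfoldedStokes — crux `UnfoldedStokesSquare`, part 1/3: engine, field, faces

Problem `KontsevichZagierPeriods`, route `UnfoldedStokes`, item stmt-KontsevichZagierPeriods-3520
(`UnfoldedStokesSquare`, crux, rank 2): the unfolded Stokes relator of the unit square lies in
`KZ.relations`.  Data: `U ⊇ [0,1]²` open and star-shaped about `0`; `a, b, c, e` of class `C¹` and
`ℚ`-semialgebraic on `U` (with the five first partials that occur also semialgebraic), the 1-form
`ω = a ds + b dt` closed (`∂ₜa = ∂ₛb`).  With `Ω(s,t,u) = s·a(us,ut) + t·b(us,ut)` the combination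
`[rB] + [rR] − [rT] − [rL] − [rW] − [rD]` of the four edge representations, the wedge representation
`rW = [D, ae − bc]` and the bulk representation `rD = [D×(0,1), Ω·(∂ₛe − ∂ₜc)]` is a KZ relation.

Line `divergence-engine-transport` (crux idea card of the same name; skeleton `SketchIdeator1.lean`
of the crux work directory, landed against the route declaration BY NAME): the crux is ONE
instance (`k = 2`) of the move-level divergence theorem on the open cube already proved in the tree
for crux `DihedralNormalForm` of route `LinRedNormalForm`
(`TameBVStokes.stub_boundedStokesMove`, its bounded-variation hypothesis discharged by
`TameBVStokes.stub_bvStokes`; both sorry-free `Theorems` files), applied to the HOMOTOPY VECTOR FIELD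
`G = (Ω·e, −Ω·c, −(u·a(up)·e − u·b(up)·c))` on `(0,1)³`: its flux through the six faces is
`rR, rL, −rT, −rB, −rW, 0` and its divergence is `rD`'s integrand `Ω·(∂ₛe − ∂ₜc)` — the closedness
`∂ₜa = ∂ₛb` enters ONLY through this pointwise identity, via the Literature lemmas
`KZ.UnfoldedStokesData.hasDerivAt_unfolding_insertNth` (closedness unfolded: `∂ⱼΩ = ∂ᵤ(u·aⱼ(up))`)
and `KZ.UnfoldedStokesData.hasDerivAt_mul_a_smul` (the radial derivative).

The proof is split by topic over three files:
* `UnfoldedStokesUnfoldedStokesSquareField`  — §0 the engine (`divergenceEngine` =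
  `stub_boundedStokesMove stub_bvStokes`) and its literal-index form in dimension 3
  (`divergenceEngine₃`); §1 the field (`dil`, `proj`, `Omega`, `fieldS/T/U`) and polynomial-map
  facts; S1 `stub_fieldSemialgebraic` (composition with polynomial maps into the star-shaped `U`);
  §3 the six face identities;
* `UnfoldedStokesUnfoldedStokesSquareStubs`  — S2 `stub_fieldRegular` (bounded / differentiable /
  fibre-continuous) and S3 `stub_fieldDiv` (the divergence identity, where closedness acts);
* `UnfoldedStokesUnfoldedStokesSquare`       — §4 the assembly (engine + `[r] + [r.neg] ∈ relations`,
  `[0] ∈ relations`, `abel`): `unfoldedStokesSquare_proof : …Theses.UnfoldedStokes.UnfoldedStokesSquare`.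

Sources: M. Kontsevich, D. Zagier, *Periods* (2001), §1.2 (the Stokes rule); R. Bott, L. Tu,
*Differential Forms in Algebraic Topology* (1982), §4 (homotopy operator of the Poincaré lemma);
P. Griffiths, J. Harris, *Principles of Algebraic Geometry* (1978), Ch. 0 (Stokes on a cell).
-/

noncomputable section

open MeasureTheory Set
open Literature.NumberTheory.Transcendental
open Literature.ModelTheory.ExponentialFields (IsSemialgebraic)

namespace Summit.KontsevichZagierPeriods.UnfoldedStokes.UnfoldedStokesSquare

open Summit.KontsevichZagierPeriods.DihedralNormalForm.TameBVStokes (stub_boundedStokesMove stub_bvStokes)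

/-! ## 0. The engine, unconditionally (BV hypothesis discharged by `stub_bvStokes`) -/

/-- **Divergence theorem on the open cube as KZ moves** (tree: `stub_boundedStokesMove stub_bvStokes`). -/
theorem divergenceEngine : ∀ (k : ℕ) (h : Fin (k + 1) → (Fin (k + 1) → ℝ) → ℝ) (C : ℝ) (r : Literature.NumberTheory.Transcendental.KZ.IntegralRep (k + 1)) (f₀ f₁ : Fin (k + 1) → Literature.NumberTheory.Transcendental.KZ.IntegralRep k), (∀ i, Literature.NumberTheory.Transcendental.IsSemialgebraicFunOn ℚ {x : Fin (k + 1) → ℝ | ∀ i, x i ∈ Set.Icc (0:ℝ) 1} (h i)) → (∀ i, ∀ x ∈ {x : Fin (k + 1) → ℝ | ∀ i, x i ∈ Set.Ioo (0:ℝ) 1}, |h i x| ≤ C) → (∀ i, ∀ x ∈ {x : Fin (k + 1) → ℝ | ∀ i, x i ∈ Set.Ioo (0:ℝ) 1}, DifferentiableAt ℝ (h i) x) → (∀ i, ∀ y ∈ {x : Fin k → ℝ | ∀ i, x i ∈ Set.Ioo (0:ℝ) 1}, ContinuousOn (fun t : ℝ => h i (Fin.insertNth i t y)) (Set.Icc 0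 1)) → r.domain = {x : Fin (k + 1) → ℝ | ∀ i, x i ∈ Set.Ioo (0:ℝ) 1} → Set.EqOn r.integrand (fun x => ∑ i, fderiv ℝ (h i) x (Pi.single i 1)) r.domain → (∀ i, (f₀ i).domain = {x : Fin k → ℝ | ∀ i, x i ∈ Set.Ioo (0:ℝ) 1} ∧ (f₁ i).domain = {x : Fin k → ℝ | ∀ i, x i ∈ Set.Ioo (0:ℝ) 1} ∧ Set.EqOn (f₀ i).integrand (fun y => h i (Fin.insertNth i 0 y)) {x : Fin k → ℝ | ∀ i, x i ∈ Set.Ioo (0:ℝ) 1} ∧ Set.EqOn (f₁ i).integrand (fun y => h i (Fin.insertNth i 1 y)) {x : Fin k → ℝ | ∀ i, x i ∈ Set.Ioo (0:ℝ) 1}) → Literature.NumberTheory.Transcendental.KZ.of r - ∑ i, (Literature.NumberTheory.Transcendental.KZ.of (f₁ i) - Literature.NumberTheory.Transcendental.KZ.of (f₀ i)) ∈ Literature.NumberTheory.Transcendental.KZ.relations :=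
  stub_boundedStokesMove stub_bvStokes

/-- A sum over `Fin (2+1)` written out with literal indices. -/
private theorem sum_three {M : Type*} [AddCommMonoid M] (f : Fin (2 + 1) → M) :
    ∑ j, f j = f (0 : Fin 3) + f (1 : Fin 3) + f (2 : Fin 3) := Fin.sum_univ_three f

/-- **The engine in dimension three, with literal indices** (no `Fin (2+1)` bookkeeping left for the
user): vector field `(h₀, h₁, h₂)` on `(0,1)³`, divergence representation `r`, faces `fᵥᵢ`
(`v` = value of the frozen coordinate `i`). -/
theorem divergenceEngine₃ (h₀ h₁ h₂ : (Fin 3 → ℝ) → ℝ) (C : ℝ) (r : KZ.IntegralRep 3)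
    (f₀₀ f₀₁ f₀₂ f₁₀ f₁₁ f₁₂ : KZ.IntegralRep 2)
    (hs₀ : IsSemialgebraicFunOn ℚ {x : Fin 3 → ℝ | ∀ i, x i ∈ Icc (0 : ℝ) 1} h₀)
    (hs₁ : IsSemialgebraicFunOn ℚ {x : Fin 3 → ℝ | ∀ i, x i ∈ Icc (0 : ℝ) 1} h₁)
    (hs₂ : IsSemialgebraicFunOn ℚ {x : Fin 3 → ℝ | ∀ i, x i ∈ Icc (0 : ℝ) 1} h₂)
    (hb₀ : ∀ x ∈ {x : Fin 3 → ℝ | ∀ i, x i ∈ Ioo (0 : ℝ) 1}, |h₀ x| ≤ C)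
    (hb₁ : ∀ x ∈ {x : Fin 3 → ℝ | ∀ i, x i ∈ Ioo (0 : ℝ) 1}, |h₁ x| ≤ C)
    (hb₂ : ∀ x ∈ {x : Fin 3 → ℝ | ∀ i, x i ∈ Ioo (0 : ℝ) 1}, |h₂ x| ≤ C)
    (hd₀ : ∀ x ∈ {x : Fin 3 → ℝ | ∀ i, x i ∈ Ioo (0 : ℝ) 1}, DifferentiableAt ℝ h₀ x)
    (hd₁ : ∀ x ∈ {x : Fin 3 → ℝ | ∀ i, x i ∈ Ioo (0 : ℝ) 1}, DifferentiableAt ℝ h₁ x)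
    (hd₂ : ∀ x ∈ {x : Fin 3 → ℝ | ∀ i, x i ∈ Ioo (0 : ℝ) 1}, DifferentiableAt ℝ h₂ x)
    (hc₀ : ∀ y ∈ {x : Fin 2 → ℝ | ∀ i, x i ∈ Ioo (0 : ℝ) 1},
      ContinuousOn (fun t : ℝ => h₀ (Fin.insertNth 0 t y)) (Icc 0 1))
    (hc₁ : ∀ y ∈ {x : Fin 2 → ℝ | ∀ i, x i ∈ Ioo (0 : ℝ) 1},
      ContinuousOn (fun t : ℝ => h₁ (Fin.insertNth 1 t y)) (Icc 0 1))
    (hc₂ : ∀ y ∈ {x : Fin 2 → ℝ | ∀ i, x i ∈ Ioo (0 : ℝ) 1},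
      ContinuousOn (fun t : ℝ => h₂ (Fin.insertNth 2 t y)) (Icc 0 1))
    (hrd : r.domain = {x : Fin 3 → ℝ | ∀ i, x i ∈ Ioo (0 : ℝ) 1})
    (hri : EqOn r.integrand (fun x => fderiv ℝ h₀ x (Pi.single 0 1) + fderiv ℝ h₁ x (Pi.single 1 1) +
      fderiv ℝ h₂ x (Pi.single 2 1)) r.domain)
    (hd₀₀ : f₀₀.domain = {x : Fin 2 → ℝ | ∀ i, x i ∈ Ioo (0 : ℝ) 1})
    (hd₀₁ : f₀₁.domain = {x : Fin 2 → ℝ | ∀ i, x i ∈ Ioo (0 : ℝ) 1})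
    (hd₀₂ : f₀₂.domain = {x : Fin 2 → ℝ | ∀ i, x i ∈ Ioo (0 : ℝ) 1})
    (hd₁₀ : f₁₀.domain = {x : Fin 2 → ℝ | ∀ i, x i ∈ Ioo (0 : ℝ) 1})
    (hd₁₁ : f₁₁.domain = {x : Fin 2 → ℝ | ∀ i, x i ∈ Ioo (0 : ℝ) 1})
    (hd₁₂ : f₁₂.domain = {x : Fin 2 → ℝ | ∀ i, x i ∈ Ioo (0 : ℝ) 1})
    (hi₀₀ : EqOn f₀₀.integrand (fun y => h₀ (Fin.insertNth 0 0 y)) {x : Fin 2 → ℝ | ∀ i, x i ∈ Ioo (0 : ℝ) 1})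
    (hi₁₀ : EqOn f₁₀.integrand (fun y => h₀ (Fin.insertNth 0 1 y)) {x : Fin 2 → ℝ | ∀ i, x i ∈ Ioo (0 : ℝ) 1})
    (hi₀₁ : EqOn f₀₁.integrand (fun y => h₁ (Fin.insertNth 1 0 y)) {x : Fin 2 → ℝ | ∀ i, x i ∈ Ioo (0 : ℝ) 1})
    (hi₁₁ : EqOn f₁₁.integrand (fun y => h₁ (Fin.insertNth 1 1 y)) {x : Fin 2 → ℝ | ∀ i, x i ∈ Ioo (0 : ℝ) 1})
    (hi₀₂ : EqOn f₀₂.integrand (fun y => h₂ (Fin.insertNth 2 0 y)) {x : Fin 2 → ℝ | ∀ i, x i ∈ Ioo (0 : ℝ) 1})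
    (hi₁₂ : EqOn f₁₂.integrand (fun y => h₂ (Fin.insertNth 2 1 y)) {x : Fin 2 → ℝ | ∀ i, x i ∈ Ioo (0 : ℝ) 1}) :
    KZ.of r - (KZ.of f₁₀ - KZ.of f₀₀ + (KZ.of f₁₁ - KZ.of f₀₁) + (KZ.of f₁₂ - KZ.of f₀₂)) ∈ KZ.relations := by
  have key := divergenceEngine 2 ![h₀, h₁, h₂] C r ![f₀₀, f₀₁, f₀₂] ![f₁₀, f₁₁, f₁₂]
    (by intro i; fin_cases i <;> assumption)
    (by intro i; fin_cases i <;> assumption)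
    (by intro i; fin_cases i <;> assumption)
    (by intro i; fin_cases i <;> assumption)
    hrd
    (by
      intro x hx
      simp only [sum_three, Matrix.cons_val_zero, Matrix.cons_val_one, Matrix.head_cons,
        Matrix.cons_val_two, Matrix.tail_cons]
      exact hri hx)
    (by
      intro i
      fin_cases i
      · exact ⟨hd₀₀, hd₁₀, hi₀₀, hi₁₀⟩
      · exact ⟨hd₀₁, hd₁₁, hi₀₁, hi₁₁⟩
      · exact ⟨hd₀₂, hd₁₂, hi₀₂, hi₁₂⟩)
  simpa only [sum_three, Matrix.cons_val_zero, Matrix.cons_val_one, Matrix.head_cons,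
    Matrix.cons_val_two, Matrix.tail_cons] using key

/-! ## 1. The homotopy vector field of the square -/

/-- The dilation `(s,t,u) ↦ (us, ut)`. -/
def dil (x : Fin 3 → ℝ) : Fin 2 → ℝ := ![x 2 * x 0, x 2 * x 1]

/-- The projection `(s,t,u) ↦ (s, t)`. -/
def proj (x : Fin 3 → ℝ) : Fin 2 → ℝ := ![x 0, x 1]

variable (U : Set (Fin 2 → ℝ)) (a b c e : (Fin 2 → ℝ) → ℝ)

/-- `Ω(s,t,u) = s·a(us,ut) + t·b(us,ut)` on `ℝ³` (coordinates `x 0 = s`, `x 1 = t`, `x 2 = u`). -/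
def Omega (x : Fin 3 → ℝ) : ℝ := x 0 * a (dil x) + x 1 * b (dil x)

/-- First component `G₀ = Ω·e(s,t)` (flux through the faces `s = 0, 1`). -/
def fieldS (x : Fin 3 → ℝ) : ℝ := Omega a b x * e (proj x)

/-- Second component `G₁ = −Ω·c(s,t)` (flux through the faces `t = 0, 1`). -/
def fieldT (x : Fin 3 → ℝ) : ℝ := -(Omega a b x * c (proj x))

/-- Third component `G₂ = −(u·a(up)·e(p) − u·b(up)·c(p))` (MINUS the radial primitive of `ω ∧ η`;
flux through `u = 0, 1`). -/
def fieldU (x : Fin 3 → ℝ) : ℝ := -(x 2 * a (dil x) * e (proj x) - x 2 * b (dil x) * c (proj x))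

/-! ### Elementary facts on the two polynomial maps -/

section Facts

variable {U}

/-- The dilation is the scalar action of the last coordinate on the projection. -/
theorem dil_eq_smul_proj (x : Fin 3 → ℝ) : dil x = x 2 • proj x := by
  ext j; fin_cases j <;> rfl

/-- The projection maps the closed cube `[0,1]³` into the closed square `[0,1]²`. -/
theorem proj_mem_Icc {x : Fin 3 → ℝ} (hx : ∀ i, x i ∈ Icc (0 : ℝ) 1) :
    proj x ∈ Icc (0 : Fin 2 → ℝ) 1 := by
  refine ⟨fun j => ?_, fun j => ?_⟩
  · fin_cases j
    · exact (hx 0).1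
    · exact (hx 1).1
  · fin_cases j
    · exact (hx 0).2
    · exact (hx 1).2

/-- The projection maps the closed cube into `U ⊇ [0,1]²`. -/
theorem proj_mem (hUI : Icc (0 : Fin 2 → ℝ) 1 ⊆ U) {x : Fin 3 → ℝ} (hx : ∀ i, x i ∈ Icc (0 : ℝ) 1) :
    proj x ∈ U :=
  hUI (proj_mem_Icc hx)

/-- The dilation maps the closed cube into `U` (star-shapedness of `U` about `0`). -/
theorem dil_mem (hUI : Icc (0 : Fin 2 → ℝ) 1 ⊆ U) (hstar : ∀ p ∈ U, ∀ u ∈ Icc (0 : ℝ) 1, u • p ∈ U)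
    {x : Fin 3 → ℝ} (hx : ∀ i, x i ∈ Icc (0 : ℝ) 1) : dil x ∈ U := by
  rw [dil_eq_smul_proj]
  exact hstar _ (proj_mem hUI hx) _ (hx 2)

/-- Points of the open cube lie in the closed cube. -/
theorem Icc_of_Ioo {x : Fin 3 → ℝ} (hx : ∀ i, x i ∈ Ioo (0 : ℝ) 1) : ∀ i, x i ∈ Icc (0 : ℝ) 1 :=
  fun i => Ioo_subset_Icc_self (hx i)

/-- The dilation is continuous. -/
theorem continuous_dil : Continuous dil :=
  continuous_pi fun j => by
    fin_cases j
    · exact (continuous_apply 2).mul (continuous_apply 0)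
    · exact (continuous_apply 2).mul (continuous_apply 1)

/-- The dilation is differentiable (polynomial map). -/
theorem differentiable_dil : Differentiable ℝ dil := fun x =>
  differentiableAt_pi.2 fun j => by
    fin_cases j
    · show DifferentiableAt ℝ (fun x : Fin 3 → ℝ => x 2 * x 0) x; fun_prop
    · show DifferentiableAt ℝ (fun x : Fin 3 → ℝ => x 2 * x 1) x; fun_prop

/-- The projection is differentiable (linear map). -/
theorem differentiable_proj : Differentiable ℝ proj := fun x =>
  differentiableAt_pi.2 fun j => by
    fin_cases j
    · show DifferentiableAt ℝ (fun x : Fin 3 → ℝ => x 0) x; fun_prop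
    · show DifferentiableAt ℝ (fun x : Fin 3 → ℝ => x 1) x; fun_prop

/-- The closed cube `[0,1]³` in the coordinatewise form of the engine is `closedUnitCube 3`. -/
theorem Q3_eq_closedUnitCube :
    {x : Fin 3 → ℝ | ∀ i, x i ∈ Icc (0 : ℝ) 1} = closedUnitCube 3 :=
  Set.ext fun _ => mem_closedUnitCube_iff.symm

/-- The closed cube `[0,1]³` is `ℚ`-semialgebraic. -/
theorem isSemialgebraic_Q3 : IsSemialgebraic ℚ {x : Fin 3 → ℝ | ∀ i, x i ∈ Icc (0 : ℝ) 1} := by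
  rw [Q3_eq_closedUnitCube]; exact isSemialgebraic_closedUnitCube

/-- The closed cube `[0,1]³` is compact. -/
theorem isCompact_Q3 : IsCompact {x : Fin 3 → ℝ | ∀ i, x i ∈ Icc (0 : ℝ) 1} := by
  rw [Q3_eq_closedUnitCube]; exact isCompact_closedUnitCube

/-- The dilation is a `ℚ`-semialgebraic map on the closed cube (it is polynomial). -/
theorem isSemialgebraicMapOn_dil :
    IsSemialgebraicMapOn ℚ {x : Fin 3 → ℝ | ∀ i, x i ∈ Icc (0 : ℝ) 1} dil :=
  (isSemialgebraicMapOn_aeval isSemialgebraic_Q3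
    (![MvPolynomial.X 2 * MvPolynomial.X 0, MvPolynomial.X 2 * MvPolynomial.X 1] :
      Fin 2 → MvPolynomial (Fin 3) ℚ)).congr fun x _ => by
    ext j; fin_cases j <;> simp [dil]

/-- The projection is a `ℚ`-semialgebraic map on the closed cube (it is polynomial). -/
theorem isSemialgebraicMapOn_proj :
    IsSemialgebraicMapOn ℚ {x : Fin 3 → ℝ | ∀ i, x i ∈ Icc (0 : ℝ) 1} proj :=
  (isSemialgebraicMapOn_aeval isSemialgebraic_Q3
    (![MvPolynomial.X 0, MvPolynomial.X 1] : Fin 2 → MvPolynomial (Fin 3) ℚ)).congr fun x _ => by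
    ext j; fin_cases j <;> simp [proj]

/-- Each coordinate function is `ℚ`-semialgebraic on the closed cube. -/
theorem isSemialgebraicFunOn_coord (i : Fin 3) :
    IsSemialgebraicFunOn ℚ {x : Fin 3 → ℝ | ∀ i, x i ∈ Icc (0 : ℝ) 1} (fun x => x i) :=
  (isSemialgebraicFunOn_aeval isSemialgebraic_Q3 (MvPolynomial.X i)).congr fun x _ => by simp

end Facts

/-! ## 2. Stubs of the line -/

/-- S1: the three components are `ℚ`-semialgebraic on the CLOSED cube (composition with the polynomial
maps `x ↦ (x₂x₀, x₂x₁)`, `x ↦ (x₀, x₁)`, which map the closed cube into `U` by star-shapedness;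
`IsSemialgebraicFunOn.comp_isSemialgebraicMapOn_holds`, `isSemialgebraicMapOn_aeval`, `fun_mul`). -/
theorem stub_fieldSemialgebraic (hUI : Icc (0 : Fin 2 → ℝ) 1 ⊆ U)
    (hstar : ∀ p ∈ U, ∀ u ∈ Icc (0 : ℝ) 1, u • p ∈ U)
    (sa : IsSemialgebraicFunOn ℚ U a) (sb : IsSemialgebraicFunOn ℚ U b)
    (sc : IsSemialgebraicFunOn ℚ U c) (se : IsSemialgebraicFunOn ℚ U e) :
    IsSemialgebraicFunOn ℚ {x : Fin 3 → ℝ | ∀ i, x i ∈ Icc (0 : ℝ) 1} (fieldS a b e) ∧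
    IsSemialgebraicFunOn ℚ {x : Fin 3 → ℝ | ∀ i, x i ∈ Icc (0 : ℝ) 1} (fieldT a b c) ∧
    IsSemialgebraicFunOn ℚ {x : Fin 3 → ℝ | ∀ i, x i ∈ Icc (0 : ℝ) 1} (fieldU a b c e) := by
  have mdil : MapsTo dil {x : Fin 3 → ℝ | ∀ i, x i ∈ Icc (0 : ℝ) 1} U := fun x hx => dil_mem hUI hstar hx
  have mproj : MapsTo proj {x : Fin 3 → ℝ | ∀ i, x i ∈ Icc (0 : ℝ) 1} U := fun x hx => proj_mem hUI hx
  have haD : IsSemialgebraicFunOn ℚ _ (a ∘ dil) :=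
    IsSemialgebraicFunOn.comp_isSemialgebraicMapOn_holds sa isSemialgebraicMapOn_dil mdil
  have hbD : IsSemialgebraicFunOn ℚ _ (b ∘ dil) :=
    IsSemialgebraicFunOn.comp_isSemialgebraicMapOn_holds sb isSemialgebraicMapOn_dil mdil
  have hcP : IsSemialgebraicFunOn ℚ _ (c ∘ proj) :=
    IsSemialgebraicFunOn.comp_isSemialgebraicMapOn_holds sc isSemialgebraicMapOn_proj mproj
  have heP : IsSemialgebraicFunOn ℚ _ (e ∘ proj) :=
    IsSemialgebraicFunOn.comp_isSemialgebraicMapOn_holds se isSemialgebraicMapOn_proj mproj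
  have h0 := isSemialgebraicFunOn_coord 0
  have h1 := isSemialgebraicFunOn_coord 1
  have h2 := isSemialgebraicFunOn_coord 2
  have hΩ : IsSemialgebraicFunOn ℚ _ (Omega a b) :=
    ((h0.fun_mul haD).fun_add (h1.fun_mul hbD)).congr fun x _ => rfl
  exact ⟨(hΩ.fun_mul heP).congr fun x _ => rfl, (hΩ.fun_mul hcP).fun_neg.congr fun x _ => rfl,
    (((h2.fun_mul haD).fun_mul heP).fun_sub ((h2.fun_mul hbD).fun_mul hcP)).fun_neg.congr
      fun x _ => rfl⟩

/-! ## 3. The six faces (pure rewriting) -/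

/-- Face `s = 1` of the first component: the right-edge integrand `rR`. -/
theorem fieldS_one (y : Fin 2 → ℝ) :
    fieldS a b e (Fin.insertNth 0 1 y) = (a ![y 1, y 1 * y 0] + y 0 * b ![y 1, y 1 * y 0]) * e ![1, y 0] := by
  simp only [fieldS, Beukers.insertNth_zero_eq, Omega, dil, proj, Matrix.cons_val_zero, Matrix.cons_val_one,
    Matrix.head_cons, Matrix.cons_val_two, Matrix.tail_cons, mul_one, one_mul]

/-- Face `s = 0` of the first component: the left-edge integrand `rL`. -/
theorem fieldS_zero (y : Fin 2 → ℝ) :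
    fieldS a b e (Fin.insertNth 0 0 y) = y 0 * b ![0, y 1 * y 0] * e ![0, y 0] := by
  simp only [fieldS, Beukers.insertNth_zero_eq, Omega, dil, proj, Matrix.cons_val_zero, Matrix.cons_val_one,
    Matrix.head_cons, Matrix.cons_val_two, Matrix.tail_cons, mul_zero, zero_mul, zero_add]

/-- Face `t = 1` of the second component: MINUS the top-edge integrand `rT`. -/
theorem fieldT_one (y : Fin 2 → ℝ) :
    fieldT a b c (Fin.insertNth 1 1 y) = -((y 0 * a ![y 1 * y 0, y 1] + b ![y 1 * y 0, y 1]) * c ![y 0, 1]) := by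
  simp only [fieldT, Beukers.insertNth_one_eq, Omega, dil, proj, Matrix.cons_val_zero, Matrix.cons_val_one,
    Matrix.head_cons, Matrix.cons_val_two, Matrix.tail_cons, mul_one, one_mul]

/-- Face `t = 0` of the second component: MINUS the bottom-edge integrand `rB`. -/
theorem fieldT_zero (y : Fin 2 → ℝ) :
    fieldT a b c (Fin.insertNth 1 0 y) = -(y 0 * a ![y 1 * y 0, 0] * c ![y 0, 0]) := by
  simp only [fieldT, Beukers.insertNth_one_eq, Omega, dil, proj, Matrix.cons_val_zero, Matrix.cons_val_one,
    Matrix.head_cons, Matrix.cons_val_two, Matrix.tail_cons, mul_zero, zero_mul, add_zero]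

/-- Face `u = 1` of the third component: MINUS the wedge integrand `rW = ae − bc`. -/
theorem fieldU_one (y : Fin 2 → ℝ) :
    fieldU a b c e (Fin.insertNth 2 1 y) = -(a ![y 0, y 1] * e ![y 0, y 1] - b ![y 0, y 1] * c ![y 0, y 1]) := by
  simp only [fieldU, Beukers.insertNth_two_eq, dil, proj, Matrix.cons_val_zero, Matrix.cons_val_one,
    Matrix.head_cons, Matrix.cons_val_two, Matrix.tail_cons, one_mul]

/-- Face `u = 0` of the third component vanishes. -/
theorem fieldU_zero (y : Fin 2 → ℝ) :
    fieldU a b c e (Fin.insertNth 2 0 y) = 0 := by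
  simp only [fieldU, Beukers.insertNth_two_eq, dil, proj, Matrix.cons_val_zero, Matrix.cons_val_one,
    Matrix.head_cons, Matrix.cons_val_two, Matrix.tail_cons, zero_mul, sub_zero, neg_zero]

end Summit.KontsevichZagierPeriods.UnfoldedStokes.UnfoldedStokesSquare

end
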